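import Literature.AlgebraicGeometry.Motives.HodgeLieBlockSummandSurjective
import Literature.AlgebraicGeometry.Motives.HodgeLieReductiveAnyWeight
import HarnessLib

/-!
# `𝔥(H₁ ⊕ H₂) = 𝔥(H₁) × 𝔥(H₂)` when `𝔥(H₁)` is centre-free and `𝔥(H₂)` is abelian (Moonen–Zarhin 1999 Thm. (3.2)(2), Lie-algebra form)

Family `hodge`, layer `Literature/AlgebraicGeometry/Motives`; THEOREMS ONLY (no definition, no named fact; net debt 0).
Written for the cell `pub-hodgecm2` (COR-CM), seat `b27` gen 43 (count-neutral Mumford–Tate-rank ladder: the CM-part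
converse `t(B^{m+1} × Z) = t(Z) + 3` of the rank-one rungs).  Sequel of `Motives/HodgeLieDirectSum` (gen 35: the diagonal
blocks `π_j X ι_j` of `X ∈ 𝔥(H)` lie in `𝔥(H_j)`), `Motives/HodgeLieBlockSummandSurjective` (gen 37: if `𝔥(H)` is block
diagonal for `e = ι π` then every `Y ∈ 𝔥(H₂)` extends by zero, `ι Y π ∈ 𝔥(H)`) and `Motives/HodgeLieReductiveAnyWeight`
(`𝔥 = 𝔷 ⊕ [𝔥, 𝔥]` with `𝔷 = 𝔥 ∩ End_Hdg`, any weight, `H` polarizable).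

PRINTED RESULT.  Moonen–Zarhin, Math. Ann. 315 (1999), §3 (3.1): «`Hg(X₁ × X₂)` is an algebraic subgroup of
`Hg(X₁) × Hg(X₂)`; the two projections are surjective», and Thm. (3.2) (after Hazama): «(2) Suppose `X₁` has no factors
of Type 4 and `X₂` is of CM-type. Then […] `Hg(X₁ × X₂) = Hg(X₁) × Hg(X₂)`» [corpus: paper:arxiv-math_9901113 p. 6].
«No factors of Type 4» ⟺ `Hg(X₁)` semisimple ⟺ the centre `𝔷(H¹X₁) = Lie Hg ∩ End⁰` vanishes (ibid. §1, (2.2)–(2.3));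
«CM-type» ⟺ `Hg(X₂)` is a torus ⟺ `Lie Hg(H¹X₂)` is abelian.

THIS FILE proves the LIE-ALGEBRA form for abstract polarizable `ℚ`-Hodge structures of any weight, WITHOUT condition (D)
and without the classification: let `H` be a polarizable pure `ℚ`-Hodge structure decomposed by morphisms
`ι_i : H_i → H`, `π_i : H → H_i` (`i = 1, 2`) with `π_i ι_i = id`, `ι₁ π₁ + ι₂ π₂ = id` (so `H ≅ H₁ ⊕ H₂`); suppose
`𝔥(H₁) ∩ End_Hdg(H₁) = 0` (centre-free) and `𝔥(H₂)` abelian.  Then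
* §2 **`comp_idempotent_mem_hodgeLie_of_centerFree_of_abelian`** — `𝔥(H)` is BLOCK DIAGONAL: `e₁ X, e₂ X ∈ 𝔥(H)` for
  `X ∈ 𝔥(H)` (`e_i = ι_i π_i`).  Proof: `X = X_z + X_d` with `X_z ∈ 𝔷(H) = 𝔥(H) ∩ End_Hdg(H)`, `X_d ∈ [𝔥(H), 𝔥(H)]`;
  the `H₂`-block of a commutator is a commutator in the abelian `𝔥(H₂)`, so `e₂ X_d = 0`, `e₁ X_d = X_d`; the `H₁`-block
  `π₁ X_z ι₁` lies in `𝔥(H₁) ∩ End_Hdg(H₁) = 0`, so `e₁ X_z = 0`; hence `e₁ X = X_d ∈ 𝔥(H)`.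
* §3 **`comp_comp_mem_hodgeLie_left/right_of_centerFree_of_abelian`** — `ι₁ Y π₁ ∈ 𝔥(H)` for `Y ∈ 𝔥(H₁)` and
  `ι₂ Y π₂ ∈ 𝔥(H)` for `Y ∈ 𝔥(H₂)` (the projections `𝔥(H) → 𝔥(H_i)` are onto, `comp_mem_hodgeLie_of_block`);
  **`mem_hodgeLie_iff_of_centerFree_of_abelian`** — `𝔥(H) = {ι₁ Y₁ π₁ + ι₂ Y₂ π₂ | Y_i ∈ 𝔥(H_i)}`, i.e.
  `𝔥(H₁ ⊕ H₂) = 𝔥(H₁) × 𝔥(H₂)`; **`finrank_hodgeLie_eq_add_of_centerFree_of_abelian`** —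
  `dim_ℚ 𝔥(H) = dim_ℚ 𝔥(H₁) + dim_ℚ 𝔥(H₂)`.
§1 is block calculus for operators commuting with `e₁` (`π₂ X ι₁ = 0`, `π₁ X ι₂ = 0`, `X = ι₁(π₁Xι₁)π₁ + ι₂(π₂Xι₂)π₂`).
For complex abelian varieties (`X₁` without factor of type IV, `X₂` of CM type) this gives
`dim Lie Hg(H¹(X₁ × X₂)) = dim Lie Hg(H¹X₁) + dim Lie Hg(H¹X₂)` (`Motives/HodgeLieOfAbelianVarietySemisimpleTimesCM`).

RELATION TO THE TREE (E-dedup).  The tensor-INVARIANT consequence of the same printed result — «rational tensors on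
`V₁ ⊕ V₂` killed by `Θ` are killed by `ι₁ 𝔤₁ π₁`», hence the product span of Hodge classes of `A^{M+1} × C^{N+1}` — is
in the tree in the WORD MODEL of `HodgeThetaAnnihilatorLieAlgebra` (`Motives/HodgeThetaAnnihilatorPerfectTimesAbelian`,
`Motives/HodgeThetaDerivedTimesAbelian`, `HodgeTheory/NoTypeIVTimesCMProductSpan`; group form on carriers:
`HodgeTheory/HodgeGroupSplitsNoTypeIVTimesCM`), via the rational annihilator algebra of a single tensor and perfectness.
What is NEW here is the statement about the Hodge Lie algebra `hodgeLie` ITSELF (the annihilator of ALL Hodge tensors,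
`Motives/ZarhinHodgeGroupLieAlgebra`): its block description and its DIMENSION, which the Mumford–Tate-rank ladder reads
(`dim MT(H¹X) = dim Lie Hg(H¹X) + 1`); the mechanism is different (reductivity `𝔥 = 𝔷 ⊕ [𝔥, 𝔥]` of the full Hodge Lie
algebra plus the surjectivity theorem `comp_mem_hodgeLie_of_block`, no word model, any weight).

## References
* [MoonenZarhin1999LowDim] B. Moonen, Yu. Zarhin, *Hodge classes on abelian varieties of low dimension*, Math. Ann. 315
  (1999), §3 (3.1) and Thm. (3.2)(2) [corpus: paper:arxiv-math_9901113 p. 6]. [cite: MoonenZarhin1999LowDim, §3 Thm. (3.2)(2)]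
* [Hazama1989] F. Hazama, *Algebraic cycles on nonsimple abelian varieties*, Duke Math. J. 58 (1989) 31–37.
  [cite: Hazama1989, Thm. (= Gordon 7.6.2)]
* [Deligne1982HodgeCycles] P. Deligne, *Hodge cycles on abelian varieties*, LNM 900 (1982), I §3.1, Prop. 3.4, Prop. 3.6.
  [cite: Deligne1982HodgeCycles, I §3.1 and Prop. 3.4]
* [Gordon1999HodgeAVSurvey] B. B. Gordon, *A survey of the Hodge conjecture for abelian varieties*, App. B of Lewis (1999),
  Thm. 7.6.2. [cite: Gordon1999HodgeAVSurvey, Thm. 7.6.2]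
-/

noncomputable section

namespace Literature.AlgebraicGeometry.Motives

namespace HodgeStructure

universe u

variable {V₁ : Type u} [AddCommGroup V₁] [Module ℚ V₁] [Module.Finite ℚ V₁]
  {V₂ : Type u} [AddCommGroup V₂] [Module ℚ V₂] [Module.Finite ℚ V₂]
  {V : Type u} [AddCommGroup V] [Module ℚ V] [Module.Finite ℚ V] [HodgeTensorFacts.{u, u}] {n : ℤ}
  {H₁ : HodgeStructure V₁ n} {H₂ : HodgeStructure V₂ n} {H : HodgeStructure V n}
  (ι₁ : Hom H₁ H) (π₁ : Hom H H₁) (ι₂ : Hom H₂ H) (π₂ : Hom H H₂)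

/-! ### §1 Block calculus for a decomposition `ι₁ π₁ + ι₂ π₂ = id` -/

section Blocks

variable (hπι₁ : ∀ v, π₁.toLinearMap (ι₁.toLinearMap v) = v) (hπι₂ : ∀ v, π₂.toLinearMap (ι₂.toLinearMap v) = v)
  (hsum : ∀ v, ι₁.toLinearMap (π₁.toLinearMap v) + ι₂.toLinearMap (π₂.toLinearMap v) = v)

omit [Module.Finite ℚ V₁] [Module.Finite ℚ V₂] [Module.Finite ℚ V] [HodgeTensorFacts.{u, u}] in
include hπι₁ hπι₂ hsum in
/-- `π₂ ι₁ = 0` for a decomposition `ι₁ π₁ + ι₂ π₂ = id` with `π₂ ι₂ = id` (private plumbing). [folklore] -/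
private theorem proj₂_incl₁_eq_zero (v : V₁) : π₂.toLinearMap (ι₁.toLinearMap v) = 0 := by
  have h := congrArg π₂.toLinearMap (hsum (ι₁.toLinearMap v))
  rw [map_add, hπι₁ v, hπι₂] at h
  exact add_eq_left.1 h

omit [Module.Finite ℚ V₁] [Module.Finite ℚ V₂] [Module.Finite ℚ V] [HodgeTensorFacts.{u, u}] in
include hπι₁ hπι₂ hsum in
/-- `π₁ ι₂ = 0` for a decomposition `ι₁ π₁ + ι₂ π₂ = id` with `π₁ ι₁ = id` (private plumbing). [folklore] -/
private theorem proj₁_incl₂_eq_zero (v : V₂) : π₁.toLinearMap (ι₂.toLinearMap v) = 0 := by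
  have h := congrArg π₁.toLinearMap (hsum (ι₂.toLinearMap v))
  rw [map_add, hπι₂ v, hπι₁] at h
  exact add_eq_left.1 h

omit [Module.Finite ℚ V₁] [Module.Finite ℚ V₂] in
include hπι₁ hπι₂ hsum in
/-- **Off-diagonal blocks of `X ∈ 𝔥(H)` vanish: `π₂ X ι₁ = 0`** (`X` commutes with the Hodge endomorphism `e₁ = ι₁ π₁`,
`commute_of_mem_hodgeLie`, and `π₂ ι₁ = 0`). [cite: Deligne1982HodgeCycles, I §3.1 and Prop. 3.4] -/
theorem proj₂_comp_comp_incl₁_eq_zero {X : Module.End ℚ V} (hX : X ∈ H.hodgeLie) :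
    π₂.toLinearMap ∘ₗ X ∘ₗ ι₁.toLinearMap = 0 := by
  have he : ι₁.toLinearMap ∘ₗ π₁.toLinearMap ∈ H.endAlg := Hom.toLinearMap_mem_endAlg (ι₁.comp π₁)
  have hXe : X * (ι₁.toLinearMap ∘ₗ π₁.toLinearMap) = (ι₁.toLinearMap ∘ₗ π₁.toLinearMap) * X :=
    commute_of_mem_hodgeLie H hX ⟨_, he⟩
  refine LinearMap.ext fun v => ?_
  have h3 := LinearMap.congr_fun hXe (ι₁.toLinearMap v)
  simp only [Module.End.mul_apply, LinearMap.comp_apply, hπι₁] at h3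
  rw [LinearMap.comp_apply, LinearMap.comp_apply, h3, proj₂_incl₁_eq_zero ι₁ π₁ ι₂ π₂ hπι₁ hπι₂ hsum,
    LinearMap.zero_apply]

omit [Module.Finite ℚ V₁] [Module.Finite ℚ V₂] in
include hπι₁ hπι₂ hsum in
/-- **Off-diagonal blocks of `X ∈ 𝔥(H)` vanish: `π₁ X ι₂ = 0`.** [cite: Deligne1982HodgeCycles, I §3.1 and Prop. 3.4] -/
theorem proj₁_comp_comp_incl₂_eq_zero {X : Module.End ℚ V} (hX : X ∈ H.hodgeLie) :
    π₁.toLinearMap ∘ₗ X ∘ₗ ι₂.toLinearMap = 0 := by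
  have he : ι₂.toLinearMap ∘ₗ π₂.toLinearMap ∈ H.endAlg := Hom.toLinearMap_mem_endAlg (ι₂.comp π₂)
  have hXe : X * (ι₂.toLinearMap ∘ₗ π₂.toLinearMap) = (ι₂.toLinearMap ∘ₗ π₂.toLinearMap) * X :=
    commute_of_mem_hodgeLie H hX ⟨_, he⟩
  refine LinearMap.ext fun v => ?_
  have h3 := LinearMap.congr_fun hXe (ι₂.toLinearMap v)
  simp only [Module.End.mul_apply, LinearMap.comp_apply, hπι₂] at h3
  rw [LinearMap.comp_apply, LinearMap.comp_apply, h3, proj₁_incl₂_eq_zero ι₁ π₁ ι₂ π₂ hπι₁ hπι₂ hsum,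
    LinearMap.zero_apply]

omit [Module.Finite ℚ V₁] [Module.Finite ℚ V₂] in
include hπι₁ hπι₂ hsum in
/-- **`X ∈ 𝔥(H)` is the sum of its diagonal blocks: `X = ι₁ (π₁ X ι₁) π₁ + ι₂ (π₂ X ι₂) π₂`.**
[cite: Deligne1982HodgeCycles, I §3.1 and Prop. 3.4] [cite: MoonenZarhin1999LowDim, §3 Thm. (3.2)(2)] -/
theorem eq_sum_blocks_of_mem_hodgeLie {X : Module.End ℚ V} (hX : X ∈ H.hodgeLie) :
    X = ι₁.toLinearMap ∘ₗ (π₁.toLinearMap ∘ₗ X ∘ₗ ι₁.toLinearMap) ∘ₗ π₁.toLinearMap +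
      ι₂.toLinearMap ∘ₗ (π₂.toLinearMap ∘ₗ X ∘ₗ ι₂.toLinearMap) ∘ₗ π₂.toLinearMap := by
  have h21 := proj₂_comp_comp_incl₁_eq_zero ι₁ π₁ ι₂ π₂ hπι₁ hπι₂ hsum hX
  have h12 := proj₁_comp_comp_incl₂_eq_zero ι₁ π₁ ι₂ π₂ hπι₁ hπι₂ hsum hX
  refine LinearMap.ext fun v => ?_
  -- expand `X v = (e₁ + e₂) X (e₁ + e₂) v`
  have hv := hsum v
  have hXv := hsum (X v)
  have hX1 := hsum (X (ι₁.toLinearMap (π₁.toLinearMap v)))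
  have hX2 := hsum (X (ι₂.toLinearMap (π₂.toLinearMap v)))
  have h21v : π₂.toLinearMap (X (ι₁.toLinearMap (π₁.toLinearMap v))) = 0 := by
    simpa only [LinearMap.comp_apply, LinearMap.zero_apply] using LinearMap.congr_fun h21 (π₁.toLinearMap v)
  have h12v : π₁.toLinearMap (X (ι₂.toLinearMap (π₂.toLinearMap v))) = 0 := by
    simpa only [LinearMap.comp_apply, LinearMap.zero_apply] using LinearMap.congr_fun h12 (π₂.toLinearMap v)
  rw [h21v, map_zero, add_zero] at hX1
  rw [h12v, map_zero, zero_add] at hX2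
  simp only [LinearMap.add_apply, LinearMap.comp_apply]
  conv_lhs => rw [← hv, map_add]
  rw [hX1, hX2]

end Blocks

/-! ### §2 Block diagonality of `𝔥(H)` when `𝔥(H₁)` is centre-free and `𝔥(H₂)` is abelian -/

section Main

variable (hπι₁ : ∀ v, π₁.toLinearMap (ι₁.toLinearMap v) = v) (hπι₂ : ∀ v, π₂.toLinearMap (ι₂.toLinearMap v) = v)
  (hsum : ∀ v, ι₁.toLinearMap (π₁.toLinearMap v) + ι₂.toLinearMap (π₂.toLinearMap v) = v)
  (ψ : H.Polarization)
  (hz₁ : H₁.hodgeLie ⊓ Subalgebra.toSubmodule H₁.endAlg = ⊥)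
  (hab₂ : ∀ A ∈ H₂.hodgeLie, ∀ B ∈ H₂.hodgeLie, A * B = B * A)

omit [Module.Finite ℚ V₁] in
include hπι₁ hπι₂ hsum hab₂ in
/-- **The `H₂`-component of a commutator in `𝔥(H)` vanishes when `𝔥(H₂)` is abelian**: `e₂ D = 0` for every
`D ∈ [𝔥(H), 𝔥(H)]` (`e₂ = ι₂ π₂`), because `π₂ [A, B] ι₂ = [π₂ A ι₂, π₂ B ι₂]` is a commutator of elements of `𝔥(H₂)`.
[cite: MoonenZarhin1999LowDim, §3 Thm. (3.2)(2)] -/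
theorem comp_eq_zero_of_mem_derived_of_abelian {D : Module.End ℚ V}
    (hD : D ∈ Submodule.span ℚ {B | ∃ X ∈ H.hodgeLie, ∃ Y ∈ H.hodgeLie, X * Y - Y * X = B}) :
    (ι₂.toLinearMap ∘ₗ π₂.toLinearMap) ∘ₗ D = 0 := by
  induction hD using Submodule.span_induction with
  | mem D hD =>
    obtain ⟨A, hA, B, hB, rfl⟩ := hD
    have hAB : A * B - B * A ∈ H.hodgeLie := H.commutator_mem_hodgeLie hA hB
    -- blocks of `A`, `B`
    have hA₂ : π₂.toLinearMap ∘ₗ A ∘ₗ ι₂.toLinearMap ∈ H₂.hodgeLie := comp_mem_hodgeLie_of_retract ι₂ π₂ hπι₂ hA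
    have hB₂ : π₂.toLinearMap ∘ₗ B ∘ₗ ι₂.toLinearMap ∈ H₂.hodgeLie := comp_mem_hodgeLie_of_retract ι₂ π₂ hπι₂ hB
    have hcomm := hab₂ _ hA₂ _ hB₂
    -- `π₂ C = (π₂ C ι₂) π₂` for `C ∈ 𝔥(H)`
    have hπA : ∀ {C : Module.End ℚ V}, C ∈ H.hodgeLie →
        ∀ x, π₂.toLinearMap (C x) = (π₂.toLinearMap ∘ₗ C ∘ₗ ι₂.toLinearMap) (π₂.toLinearMap x) := by
      intro C hC x
      have h := eq_sum_blocks_of_mem_hodgeLie ι₁ π₁ ι₂ π₂ hπι₁ hπι₂ hsum hC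
      conv_lhs => rw [h]
      simp only [LinearMap.add_apply, LinearMap.comp_apply, map_add, hπι₂,
        proj₂_incl₁_eq_zero ι₁ π₁ ι₂ π₂ hπι₁ hπι₂ hsum, zero_add]
    set a := π₂.toLinearMap ∘ₗ A ∘ₗ ι₂.toLinearMap with ha
    set b := π₂.toLinearMap ∘ₗ B ∘ₗ ι₂.toLinearMap with hb
    have hc : ∀ y, a (b y) = b (a y) := fun y => by
      have h := LinearMap.congr_fun hcomm y
      simpa only [Module.End.mul_apply] using h
    refine LinearMap.ext fun v => ?_
    simp only [LinearMap.comp_apply, LinearMap.sub_apply, Module.End.mul_apply, LinearMap.zero_apply, map_sub]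
    rw [hπA hA (B v), hπA hB v, hπA hB (A v), hπA hA v, hc, sub_self]
  | zero => rw [LinearMap.comp_zero]
  | add D D' _ _ hD hD' => rw [LinearMap.comp_add, hD, hD', add_zero]
  | smul c D _ hD => rw [LinearMap.comp_smul, hD, smul_zero]

omit [Module.Finite ℚ V₂] in
include hπι₁ hπι₂ hsum hz₁ in
/-- **The `H₁`-component of a central element of `𝔥(H)` vanishes when `𝔥(H₁)` is centre-free**: `e₁ Z = 0` for every
`Z ∈ 𝔥(H) ∩ End_Hdg(H)`, because `π₁ Z ι₁ ∈ 𝔥(H₁) ∩ End_Hdg(H₁) = 0`. [cite: MoonenZarhin1999LowDim, §3 Thm. (3.2)(2)] -/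
theorem comp_eq_zero_of_mem_center_of_centerFree {Z : Module.End ℚ V} (hZ : Z ∈ H.hodgeLie)
    (hZe : Z ∈ H.endAlg) : (ι₁.toLinearMap ∘ₗ π₁.toLinearMap) ∘ₗ Z = 0 := by
  have hZ₁ : π₁.toLinearMap ∘ₗ Z ∘ₗ ι₁.toLinearMap ∈ H₁.hodgeLie := comp_mem_hodgeLie_of_retract ι₁ π₁ hπι₁ hZ
  have hZ₁e : π₁.toLinearMap ∘ₗ Z ∘ₗ ι₁.toLinearMap ∈ H₁.endAlg :=
    Hom.toLinearMap_mem_endAlg (π₁.comp ((endAlg.toHom ⟨Z, hZe⟩).comp ι₁))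
  have h0 : π₁.toLinearMap ∘ₗ Z ∘ₗ ι₁.toLinearMap = 0 := by
    have h := Submodule.mem_inf.2 ⟨hZ₁, (Subalgebra.mem_toSubmodule _).2 hZ₁e⟩
    rwa [hz₁, Submodule.mem_bot] at h
  have h := eq_sum_blocks_of_mem_hodgeLie ι₁ π₁ ι₂ π₂ hπι₁ hπι₂ hsum hZ
  refine LinearMap.ext fun v => ?_
  conv_lhs => rw [h]
  have h0v := LinearMap.congr_fun h0
  simp only [LinearMap.comp_apply, LinearMap.zero_apply] at h0v
  simp only [LinearMap.comp_apply, LinearMap.add_apply, h0v, map_zero, zero_add,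
    proj₁_incl₂_eq_zero ι₁ π₁ ι₂ π₂ hπι₁ hπι₂ hsum, LinearMap.zero_apply]

include hπι₁ hπι₂ hsum ψ hz₁ hab₂ in
/-- **`𝔥(H)` is block diagonal for `e₁ = ι₁ π₁`** when `𝔥(H₁)` is centre-free and `𝔥(H₂)` is abelian: `e₁ X ∈ 𝔥(H)` for
every `X ∈ 𝔥(H)`.  Indeed `X = X_z + X_d` (`𝔥 = 𝔷 ⊕ [𝔥, 𝔥]`, `AnyWeight.hodgeLie_center_sup_derived_eq`) with
`e₁ X_z = 0` and `e₁ X_d = X_d`, so `e₁ X = X_d`. [cite: MoonenZarhin1999LowDim, §3 Thm. (3.2)(2)]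
[cite: Deligne1982HodgeCycles, I §3.1 and Prop. 3.4] -/
theorem comp_incl₁_proj₁_mem_hodgeLie_of_centerFree_of_abelian {X : Module.End ℚ V} (hX : X ∈ H.hodgeLie) :
    (ι₁.toLinearMap ∘ₗ π₁.toLinearMap) ∘ₗ X ∈ H.hodgeLie := by
  have hdec := AnyWeight.hodgeLie_center_sup_derived_eq H ψ
  have hX' := hX
  rw [← hdec] at hX'
  obtain ⟨Z, hZ, D, hD, rfl⟩ := Submodule.mem_sup.1 hX'
  obtain ⟨hZ𝔥, hZe⟩ := Submodule.mem_inf.1 hZ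
  have hD𝔥 : D ∈ H.hodgeLie := by
    have h := Submodule.sub_mem _ hX hZ𝔥
    rwa [add_sub_cancel_left] at h
  have h1 : (ι₁.toLinearMap ∘ₗ π₁.toLinearMap) ∘ₗ Z = 0 :=
    comp_eq_zero_of_mem_center_of_centerFree ι₁ π₁ ι₂ π₂ hπι₁ hπι₂ hsum hz₁ hZ𝔥 hZe
  have h2 : (ι₂.toLinearMap ∘ₗ π₂.toLinearMap) ∘ₗ D = 0 :=
    comp_eq_zero_of_mem_derived_of_abelian ι₁ π₁ ι₂ π₂ hπι₁ hπι₂ hsum hab₂ hD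
  have h3 : (ι₁.toLinearMap ∘ₗ π₁.toLinearMap) ∘ₗ D = D := by
    refine LinearMap.ext fun v => ?_
    have h2v := LinearMap.congr_fun h2 v
    simp only [LinearMap.comp_apply, LinearMap.zero_apply] at h2v
    have hs := hsum (D v)
    rw [h2v, add_zero] at hs
    simpa only [LinearMap.comp_apply] using hs
  rw [LinearMap.comp_add, h1, h3, zero_add]
  exact hD𝔥

include hπι₁ hπι₂ hsum ψ hz₁ hab₂ in
/-- **`𝔥(H)` is block diagonal for `e₂ = ι₂ π₂`** (`e₂ X = X − e₁ X`). [cite: MoonenZarhin1999LowDim, §3 Thm. (3.2)(2)] -/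
theorem comp_incl₂_proj₂_mem_hodgeLie_of_centerFree_of_abelian {X : Module.End ℚ V} (hX : X ∈ H.hodgeLie) :
    (ι₂.toLinearMap ∘ₗ π₂.toLinearMap) ∘ₗ X ∈ H.hodgeLie := by
  have h1 := comp_incl₁_proj₁_mem_hodgeLie_of_centerFree_of_abelian ι₁ π₁ ι₂ π₂ hπι₁ hπι₂ hsum ψ hz₁ hab₂ hX
  have heq : (ι₂.toLinearMap ∘ₗ π₂.toLinearMap) ∘ₗ X = X - (ι₁.toLinearMap ∘ₗ π₁.toLinearMap) ∘ₗ X := by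
    refine LinearMap.ext fun v => ?_
    simp only [LinearMap.comp_apply, LinearMap.sub_apply]
    exact eq_sub_of_add_eq' (hsum (X v))
  rw [heq]
  exact Submodule.sub_mem _ hX h1

/-! ### §3 `𝔥(H) = 𝔥(H₁) × 𝔥(H₂)` -/

include hπι₁ hπι₂ hsum ψ hz₁ hab₂ in
/-- **Every `Y ∈ 𝔥(H₁)` extends by zero: `ι₁ Y π₁ ∈ 𝔥(H)`** — the projection `𝔥(H) → 𝔥(H₁)` is onto
(`comp_mem_hodgeLie_of_block` for the block-diagonal summand `H₁`). [cite: MoonenZarhin1999LowDim, §3 Thm. (3.2)(2)]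
[cite: Deligne1982HodgeCycles, I §3.1 and Prop. 3.4] -/
theorem comp_comp_mem_hodgeLie_left_of_centerFree_of_abelian {Y : Module.End ℚ V₁} (hY : Y ∈ H₁.hodgeLie) :
    ι₁.toLinearMap ∘ₗ Y ∘ₗ π₁.toLinearMap ∈ H.hodgeLie :=
  comp_mem_hodgeLie_of_block ι₁ π₁ hπι₁
    (fun _ hX => comp_incl₁_proj₁_mem_hodgeLie_of_centerFree_of_abelian ι₁ π₁ ι₂ π₂ hπι₁ hπι₂ hsum ψ hz₁ hab₂ hX) hY

include hπι₁ hπι₂ hsum ψ hz₁ hab₂ in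
/-- **Every `Y ∈ 𝔥(H₂)` extends by zero: `ι₂ Y π₂ ∈ 𝔥(H)`** — the projection `𝔥(H) → 𝔥(H₂)` is onto.
[cite: MoonenZarhin1999LowDim, §3 Thm. (3.2)(2)] [cite: Deligne1982HodgeCycles, I §3.1 and Prop. 3.4] -/
theorem comp_comp_mem_hodgeLie_right_of_centerFree_of_abelian {Y : Module.End ℚ V₂} (hY : Y ∈ H₂.hodgeLie) :
    ι₂.toLinearMap ∘ₗ Y ∘ₗ π₂.toLinearMap ∈ H.hodgeLie :=
  comp_mem_hodgeLie_of_block ι₂ π₂ hπι₂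
    (fun _ hX => comp_incl₂_proj₂_mem_hodgeLie_of_centerFree_of_abelian ι₁ π₁ ι₂ π₂ hπι₁ hπι₂ hsum ψ hz₁ hab₂ hX) hY

include hπι₁ hπι₂ hsum ψ hz₁ hab₂ in
/-- **`𝔥(H₁ ⊕ H₂) = 𝔥(H₁) × 𝔥(H₂)`** (Moonen–Zarhin Thm. (3.2)(2), Lie-algebra form, for abstract polarizable Hodge
structures): when `𝔥(H₁)` is centre-free and `𝔥(H₂)` is abelian, `X ∈ 𝔥(H)` iff `X = ι₁ Y₁ π₁ + ι₂ Y₂ π₂` with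
`Y₁ ∈ 𝔥(H₁)`, `Y₂ ∈ 𝔥(H₂)`. [cite: MoonenZarhin1999LowDim, §3 Thm. (3.2)(2)] [cite: Hazama1989, Thm. (= Gordon 7.6.2)] -/
theorem mem_hodgeLie_iff_of_centerFree_of_abelian (X : Module.End ℚ V) :
    X ∈ H.hodgeLie ↔ ∃ Y₁ ∈ H₁.hodgeLie, ∃ Y₂ ∈ H₂.hodgeLie,
      X = ι₁.toLinearMap ∘ₗ Y₁ ∘ₗ π₁.toLinearMap + ι₂.toLinearMap ∘ₗ Y₂ ∘ₗ π₂.toLinearMap := by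
  constructor
  · intro hX
    exact ⟨_, comp_mem_hodgeLie_of_retract ι₁ π₁ hπι₁ hX, _, comp_mem_hodgeLie_of_retract ι₂ π₂ hπι₂ hX,
      eq_sum_blocks_of_mem_hodgeLie ι₁ π₁ ι₂ π₂ hπι₁ hπι₂ hsum hX⟩
  · rintro ⟨Y₁, hY₁, Y₂, hY₂, rfl⟩
    exact Submodule.add_mem _
      (comp_comp_mem_hodgeLie_left_of_centerFree_of_abelian ι₁ π₁ ι₂ π₂ hπι₁ hπι₂ hsum ψ hz₁ hab₂ hY₁)
      (comp_comp_mem_hodgeLie_right_of_centerFree_of_abelian ι₁ π₁ ι₂ π₂ hπι₁ hπι₂ hsum ψ hz₁ hab₂ hY₂)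

include hπι₁ hπι₂ hsum ψ hz₁ hab₂ in
/-- **`dim_ℚ 𝔥(H₁ ⊕ H₂) = dim_ℚ 𝔥(H₁) + dim_ℚ 𝔥(H₂)`** when `𝔥(H₁)` is centre-free and `𝔥(H₂)` is abelian: the block
map `(Y₁, Y₂) ↦ ι₁ Y₁ π₁ + ι₂ Y₂ π₂` is a linear bijection `𝔥(H₁) × 𝔥(H₂) ≅ 𝔥(H)` (injective by `π_i (·) ι_i`).
For complex abelian varieties: `dim Hg(X₁ × X₂) = dim Hg(X₁) + dim Hg(X₂)` for `X₁` without factor of type IV and `X₂`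
of CM type. [cite: MoonenZarhin1999LowDim, §3 Thm. (3.2)(2)] [cite: Hazama1989, Thm. (= Gordon 7.6.2)] -/
theorem finrank_hodgeLie_eq_add_of_centerFree_of_abelian :
    Module.finrank ℚ H.hodgeLie = Module.finrank ℚ H₁.hodgeLie + Module.finrank ℚ H₂.hodgeLie := by
  -- the block map
  let Φ : (H₁.hodgeLie × H₂.hodgeLie) →ₗ[ℚ] H.hodgeLie :=
    { toFun := fun Y => ⟨ι₁.toLinearMap ∘ₗ (Y.1 : Module.End ℚ V₁) ∘ₗ π₁.toLinearMap +
          ι₂.toLinearMap ∘ₗ (Y.2 : Module.End ℚ V₂) ∘ₗ π₂.toLinearMap,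
        (mem_hodgeLie_iff_of_centerFree_of_abelian ι₁ π₁ ι₂ π₂ hπι₁ hπι₂ hsum ψ hz₁ hab₂ _).2
          ⟨_, Y.1.2, _, Y.2.2, rfl⟩⟩
      map_add' := fun Y Z => Subtype.ext (by
        simp only [Prod.fst_add, Prod.snd_add, Submodule.coe_add, LinearMap.comp_add, LinearMap.add_comp]
        abel)
      map_smul' := fun c Y => Subtype.ext (by
        simp only [Prod.smul_fst, Prod.smul_snd, Submodule.coe_smul, LinearMap.comp_smul, LinearMap.smul_comp,
          RingHom.id_apply, smul_add]) }
  have hΦ : ∀ Y : H₁.hodgeLie × H₂.hodgeLie, ((Φ Y : H.hodgeLie) : Module.End ℚ V) =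
      ι₁.toLinearMap ∘ₗ (Y.1 : Module.End ℚ V₁) ∘ₗ π₁.toLinearMap +
        ι₂.toLinearMap ∘ₗ (Y.2 : Module.End ℚ V₂) ∘ₗ π₂.toLinearMap := fun _ => rfl
  -- recovering the blocks
  have hb₁ : ∀ (Y₁ : Module.End ℚ V₁) (Y₂ : Module.End ℚ V₂),
      π₁.toLinearMap ∘ₗ (ι₁.toLinearMap ∘ₗ Y₁ ∘ₗ π₁.toLinearMap + ι₂.toLinearMap ∘ₗ Y₂ ∘ₗ π₂.toLinearMap) ∘ₗ
        ι₁.toLinearMap = Y₁ := fun Y₁ Y₂ => by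
    refine LinearMap.ext fun v => ?_
    simp only [LinearMap.comp_apply, LinearMap.add_apply, hπι₁,
      proj₂_incl₁_eq_zero ι₁ π₁ ι₂ π₂ hπι₁ hπι₂ hsum, map_zero, add_zero]
  have hb₂ : ∀ (Y₁ : Module.End ℚ V₁) (Y₂ : Module.End ℚ V₂),
      π₂.toLinearMap ∘ₗ (ι₁.toLinearMap ∘ₗ Y₁ ∘ₗ π₁.toLinearMap + ι₂.toLinearMap ∘ₗ Y₂ ∘ₗ π₂.toLinearMap) ∘ₗ
        ι₂.toLinearMap = Y₂ := fun Y₁ Y₂ => by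
    refine LinearMap.ext fun v => ?_
    simp only [LinearMap.comp_apply, LinearMap.add_apply, hπι₂, map_zero,
      proj₁_incl₂_eq_zero ι₁ π₁ ι₂ π₂ hπι₁ hπι₂ hsum, zero_add]
  have hinj : Function.Injective Φ := fun Y Z hYZ => by
    have h := congrArg (fun W : H.hodgeLie => (W : Module.End ℚ V)) hYZ
    simp only [hΦ] at h
    refine Prod.ext (Subtype.ext ?_) (Subtype.ext ?_)
    · rw [← hb₁ (Y.1 : Module.End ℚ V₁) (Y.2 : Module.End ℚ V₂), h, hb₁]
    · rw [← hb₂ (Y.1 : Module.End ℚ V₁) (Y.2 : Module.End ℚ V₂), h, hb₂]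
  have hsurj : Function.Surjective Φ := fun W => by
    obtain ⟨Y₁, hY₁, Y₂, hY₂, hW⟩ :=
      (mem_hodgeLie_iff_of_centerFree_of_abelian ι₁ π₁ ι₂ π₂ hπι₁ hπι₂ hsum ψ hz₁ hab₂ _).1 W.2
    exact ⟨(⟨Y₁, hY₁⟩, ⟨Y₂, hY₂⟩), Subtype.ext (by rw [hΦ]; exact hW.symm)⟩
  rw [← (LinearEquiv.ofBijective Φ ⟨hinj, hsurj⟩).finrank_eq, Module.finrank_prod]

end Main

end HodgeStructure

end Literature.AlgebraicGeometry.Motives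

end
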